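import Literature.Geometry.Kaehler.LelongNumberExists
import Literature.Geometry.Kaehler.LeviPositivityRadial
import HarnessLib

/-!
# The comparison inequality for Monge–Ampère masses along an analytic set (regularised maximum)

The inequalities `n(A, a) ≤ μ_a(A)` and `μ_a(A) ≤ n(A, a)` between the Lelong number of a pure
`p`-dimensional analytic set `A` at `a` and the multiplicity of a good projection
([Chirka1989, §15.1 Prop. 2]; [Demailly, *Complex analytic and differential geometry*, Ch. III
Thm. 7.7, Cor. 7.8]) are both instances of one **comparison inequality** for the `d`-closed
chain `[A]`: if `u, φ_in, φ_out` are smooth weights on `V` with `(dd^c u)^p(ξ_A) ≥ 0` on `reg A`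
(e.g. `u` a regularised maximum of plurisubharmonic weights), `u = φ_in` near the points of
`reg A ∩ S` and `u = φ_out` near the points of `reg A ∩ U'` outside a compact `K ⊆ U'`
(`S ⊆ U' ⊆ Ω`, `U'` open), then

`∫_{reg A ∩ S} (dd^c φ_in)^p(ξ_A) d𝓗 ≤ ∫_{reg A ∩ U'} (dd^c φ_out)^p(ξ_A) d𝓗`

(`setIntegral_twoPow_ddcForm_le_of_comparison`): Stokes (`setIntegral_twoPow_ddcForm_eq_of_isCompact`,
`ChainRadialStokes.lean`) replaces `φ_out` by `u` on `U'`, positivity discards `U' ∖ S`, and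
locality of `dd^c` replaces `u` by `φ_in` on `S`. This file also provides the weights of the
application: regularised maxima (`smoothMax`, `Literature/Analysis/Pluripotential/RegularisedMax.lean`)
of radial profile weights `w_h(z) = g(log ‖z - a‖)` (`radialWeight`) and of their cylindrical
analogues `g(log ‖ℓ z - b‖)` for a complex-linear `ℓ : V → K` — smoothness, non-negativity of the
Monge–Ampère densities along chains (`LeviPositivityRadial.lean`), the pull-back formula
`(dd^c (g ∘ ℓ))^p(ξ) = (dd^c g)^p(ℓ ∘ ξ)` (`twoPow_ddcForm_comp_clm_apply`), the two-sided bounds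
`max(0, x - s - ε) ≤ g(x) ≤ max(0, x - s - ε) + 2ε` of the profile primitives
(`profileWeight_ge`, `profileWeight_le`), and the branch selection of the regularised maximum
near points of strict inequality (`smoothMax_eventuallyEq_left/right`).

## References

* E. M. Chirka, *Complex Analytic Sets*, Kluwer 1989, §15.1 Prop. 2 [Chirka1989].
* J.-P. Demailly, *Complex analytic and differential geometry*, Ch. III §7 (Thm. 7.1, 7.7).
-/

noncomputable section

open scoped Manifold Topology ENNReal InnerProductSpace ContDiff
open Set Filter MeasureTheory Metric Module Complex

universe u

namespace Literature.Geometry.Kaehler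

open Literature.Geometry.GeometricMeasureTheory Literature.Analysis.Pluripotential TwoForm

/-! ### Bounds for profile weights -/

section Profile

variable {h : ℝ → ℝ} {s ε : ℝ}

/-- The scale of a profile transition is positive. [folklore] -/
theorem _root_.Literature.Geometry.GeometricMeasureTheory.IsProfileTransition.eps_pos (hh : IsProfileTransition h s ε) : 0 < ε := by
  by_contra hε
  rw [not_lt] at hε
  have h0 : h s = 0 := hh.eq_zero_of_le s (by linarith)
  have h1 : h s = 1 := hh.eq_one_of_le s (by linarith)
  rw [h0] at h1
  exact zero_ne_one h1

/-- `0 ≤ g(s + ε) ≤ 2ε` for the profile primitive `g`. [folklore] -/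
theorem _root_.Literature.Geometry.GeometricMeasureTheory.IsProfileTransition.profilePrimitive_apply_le (hh : IsProfileTransition h s ε) :
    profilePrimitive h s ε (s + ε) ≤ 2 * ε := by
  rw [profilePrimitive]
  have hle : s - ε ≤ s + ε := by linarith [hh.eps_pos]
  calc ∫ y in (s - ε)..(s + ε), h y ≤ ∫ _ in (s - ε)..(s + ε), (1 : ℝ) :=
        intervalIntegral.integral_mono_on hle (hh.contDiff.continuous.intervalIntegrable _ _)
          (continuous_const.intervalIntegrable _ _) fun y _ => hh.le_one y
    _ = 2 * ε := by rw [intervalIntegral.integral_const, smul_eq_mul, mul_one]; ring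

/-- **Lower bound**: `g(x) ≥ x - s - ε`, i.e. `F(t) ≥ ½ log t - s - ε` for `t > 0`. [folklore] -/
theorem _root_.Literature.Geometry.GeometricMeasureTheory.IsProfileTransition.profileWeight_ge (hh : IsProfileTransition h s ε) {t : ℝ} (ht : 0 < t) :
    Real.log t / 2 - s - ε ≤ profileWeight h s ε t := by
  rw [IsProfileTransition.profileWeight_of_pos ht]
  set x := Real.log t / 2
  rcases le_total (s + ε) x with hx | hx
  · rw [hh.profilePrimitive_eq_of_le hx]
    linarith [hh.profilePrimitive_nonneg (s + ε)]
  · linarith [hh.profilePrimitive_nonneg x]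

/-- **Upper bound**: `g(x) ≤ max(0, x - s - ε) + 2ε`, i.e.
`F(t) ≤ max(0, ½ log t - s - ε) + 2ε` for all `t`. [folklore] -/
theorem _root_.Literature.Geometry.GeometricMeasureTheory.IsProfileTransition.profileWeight_le (hh : IsProfileTransition h s ε) (t : ℝ) :
    profileWeight h s ε t ≤ max 0 (Real.log t / 2 - s - ε) + 2 * ε := by
  have h2ε := hh.profilePrimitive_apply_le
  rcases le_or_gt t 0 with ht | ht
  · rw [IsProfileTransition.profileWeight_of_nonpos ht]
    linarith [le_max_left (0 : ℝ) (Real.log t / 2 - s - ε), hh.eps_pos]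
  rw [IsProfileTransition.profileWeight_of_pos ht]
  set x := Real.log t / 2
  rcases le_total (s + ε) x with hx | hx
  · rw [hh.profilePrimitive_eq_of_le hx]
    linarith [le_max_right (0 : ℝ) (x - s - ε)]
  · -- monotonicity of `g` (`g' = h ≥ 0`)
    have hmono : profilePrimitive h s ε x ≤ profilePrimitive h s ε (s + ε) := by
      rw [profilePrimitive, profilePrimitive]
      have hadd := intervalIntegral.integral_add_adjacent_intervals (μ := volume) (a := s - ε) (b := x)
        (c := s + ε) (hh.contDiff.continuous.intervalIntegrable _ _)
        (hh.contDiff.continuous.intervalIntegrable _ _)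
      linarith [intervalIntegral.integral_nonneg (μ := volume) hx fun y _ => hh.nonneg y]
    linarith [le_max_left (0 : ℝ) (x - s - ε)]

/-- The profile weight is non-negative. [folklore] -/
theorem _root_.Literature.Geometry.GeometricMeasureTheory.IsProfileTransition.profileWeight_nonneg (hh : IsProfileTransition h s ε) (t : ℝ) :
    0 ≤ profileWeight h s ε t := by
  rcases le_or_gt t 0 with ht | ht
  · rw [IsProfileTransition.profileWeight_of_nonpos ht]
  · rw [IsProfileTransition.profileWeight_of_pos ht]; exact hh.profilePrimitive_nonneg _

end Profile

/-! ### The regularised maximum near points of strict inequality -/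

section SmoothMaxLocal

variable {X : Type*} [TopologicalSpace X] {a b : X → ℝ} {η : ℝ} {z : X}

/-- Where `b + η < a` the regularised maximum is `a`, on a neighbourhood. [folklore] -/
theorem smoothMax_eventuallyEq_left (hη : 0 < η) (ha : Continuous a) (hb : Continuous b)
    (h : b z + η < a z) : (fun y => smoothMax η (a y) (b y)) =ᶠ[𝓝 z] a := by
  have hopen : IsOpen {y | b y + η < a y} := isOpen_lt (hb.add continuous_const) ha
  filter_upwards [hopen.mem_nhds h] with y hy
  exact smoothMax_eq_left hη hy.le

/-- Where `a + η < b` the regularised maximum is `b`, on a neighbourhood. [folklore] -/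
theorem smoothMax_eventuallyEq_right (hη : 0 < η) (ha : Continuous a) (hb : Continuous b)
    (h : a z + η < b z) : (fun y => smoothMax η (a y) (b y)) =ᶠ[𝓝 z] b := by
  have hopen : IsOpen {y | a y + η < b y} := isOpen_lt (ha.add continuous_const) hb
  filter_upwards [hopen.mem_nhds h] with y hy
  exact smoothMax_eq_right hη hy.le

end SmoothMaxLocal

/-! ### Weights on a complex inner product space -/

variable {V : Type u} [NormedAddCommGroup V] [InnerProductSpace ℂ V]

section Weights

variable {K : Type*} [NormedAddCommGroup K] [InnerProductSpace ℂ K]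

/-- **Pull-back of `dd^c` under a continuous complex-linear map**:
`dd^c(g ∘ ℓ)(z) = (dd^c g)(ℓ z) ∘ ℓ`. [folklore] -/
theorem ddcForm_comp_clm (ℓ : V →L[ℂ] K) {g : K → ℝ} (hg : ContDiff ℝ 2 g) (z : V) :
    ddcForm (fun y => g (ℓ y)) z = (ddcForm g (ℓ z)).compContinuousLinearMap (ℓ.restrictScalars ℝ) := by
  have hg2 : ∀ w, DifferentiableAt ℝ (fderiv ℝ g) w := fun w =>
    ((hg.fderiv_right (m := 1) le_rfl).differentiable one_ne_zero).differentiableAt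
  have hgl : ContDiff ℝ 2 fun y => g (ℓ y) := hg.comp (ℓ.restrictScalars ℝ).contDiff
  have hgl2 : DifferentiableAt ℝ (fderiv ℝ fun y => g (ℓ y)) z :=
    ((hgl.fderiv_right (m := 1) le_rfl).differentiable one_ne_zero).differentiableAt
  ext v
  rw [ddcForm_apply hgl2, ContinuousAlternatingMap.compContinuousLinearMap_apply, ddcForm_apply (hg2 _)]
  have h := fderiv_fderiv_comp_clm_apply (ℓ.restrictScalars ℝ) hg z
  simp only [ContinuousLinearMap.coe_restrictScalars'] at h
  simp only [h, Function.comp_apply, ContinuousLinearMap.coe_restrictScalars', ℓ.map_smul]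

/-- **Pull-back of the Monge–Ampère density**: `(dd^c (g ∘ ℓ))(z)^p(ξ) = (dd^c g)(ℓ z)^p(ℓ ∘ ξ)`.
[folklore] -/
theorem twoPow_ddcForm_comp_clm_apply (ℓ : V →L[ℂ] K) {g : K → ℝ} (hg : ContDiff ℝ 2 g) (z : V)
    (p : ℕ) (ξ : Fin (2 * p) → V) :
    (ddcForm (fun y => g (ℓ y)) z).twoPow p ξ = (ddcForm g (ℓ z)).twoPow p (fun i => ℓ (ξ i)) := by
  rw [ddcForm_comp_clm ℓ hg z, ContinuousAlternatingMap.twoPow_compContinuousLinearMap,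
    ContinuousAlternatingMap.compContinuousLinearMap_apply]
  rfl

variable {h : ℝ → ℝ} {s ε : ℝ}

/-- The cylindrical profile weight `z ↦ w_h(ℓ z)` is smooth. [folklore] -/
theorem _root_.Literature.Geometry.GeometricMeasureTheory.IsProfileTransition.contDiff_radialWeight_comp (hh : IsProfileTransition h s ε) (ℓ : V →L[ℂ] K)
    (b : K) : ContDiff ℝ ∞ fun z => radialWeight h s ε b (ℓ z) :=
  (hh.contDiff_radialWeight b).comp (ℓ.restrictScalars ℝ).contDiff

/-- **Radial profile weights are plurisubharmonic**: `Levi(w_h)(z) ≥ 0`. [cite: Chirka1989, §13.2] -/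
theorem _root_.Literature.Geometry.GeometricMeasureTheory.IsProfileTransition.levi_radialWeight_nonneg (hh : IsProfileTransition h s ε) (a z v : V) :
    0 ≤ fderiv ℝ (fderiv ℝ (radialWeight h s ε a)) z v v +
        fderiv ℝ (fderiv ℝ (radialWeight h s ε a)) z (I • v) (I • v) := by
  have key : fderiv ℝ (fderiv ℝ (radialWeight h s ε a)) z =
      fderiv ℝ (fderiv ℝ fun x : V => profileWeight h s ε (‖x‖ ^ 2)) (z - a) :=
    fderiv_fderiv_comp_sub (fun x : V => profileWeight h s ε (‖x‖ ^ 2)) a z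
  rw [key]
  exact levi_comp_norm_sq_nonneg (hh.contDiff_profileWeight.of_le (by norm_cast)) (z - a)
    (hh.deriv_profileWeight_nonneg _) (hh.deriv_add_mul_deriv_deriv_profileWeight_nonneg _) v

/-- **Cylindrical profile weights are plurisubharmonic**: `Levi(w_h ∘ ℓ)(z) ≥ 0`. [cite: Chirka1989, §13.2] -/
theorem _root_.Literature.Geometry.GeometricMeasureTheory.IsProfileTransition.levi_radialWeight_comp_nonneg (hh : IsProfileTransition h s ε) (ℓ : V →L[ℂ] K)
    (b : K) (z v : V) :
    0 ≤ fderiv ℝ (fderiv ℝ (fun y => radialWeight h s ε b (ℓ y))) z v v +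
        fderiv ℝ (fderiv ℝ (fun y => radialWeight h s ε b (ℓ y))) z (I • v) (I • v) := by
  rw [levi_comp_clm ℓ ((hh.contDiff_radialWeight b).of_le (by norm_cast))]
  exact hh.levi_radialWeight_nonneg b (ℓ z) (ℓ v)

/-- **Positivity of the Monge–Ampère density of a regularised maximum of scaled profile weights**:
for `u = m_η(l₁ w₁ + c₁, l₂ w₂ + c₂)` with `w₁` radial, `w₂` cylindrical, `l₁, l₂ ≥ 0`,
`(dd^c u)(z)^{q+1}(ξ_T(z)) ≥ 0` at every carrier point of a holomorphic `(q+1)`-chain.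
[cite: Chirka1989, §15.1; HormanderSCV1973, Thm. 2.6.2] -/
theorem HolomorphicChain.twoPow_ddcForm_smoothMax_nonneg [FiniteDimensional ℂ V] [MeasurableSpace V]
    [BorelSpace V] {Ω : TopologicalSpace.Opens V} {q : ℕ} (T : HolomorphicChain 𝓘(ℂ, V) Ω (q + 1))
    {h₁ h₂ : ℝ → ℝ} {s₁ ε₁ s₂ ε₂ : ℝ} (hh₁ : IsProfileTransition h₁ s₁ ε₁)
    (hh₂ : IsProfileTransition h₂ s₂ ε₂) (a : V) (ℓ : V →L[ℂ] K) (b : K) {l₁ l₂ : ℝ} (hl₁ : 0 ≤ l₁)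
    (hl₂ : 0 ≤ l₂) (c₁ c₂ : ℝ) {η : ℝ} (hη : 0 < η) {z : V} (hz : z ∈ T.carrier) :
    0 ≤ (ddcForm (fun y => smoothMax η (l₁ * radialWeight h₁ s₁ ε₁ a y + c₁)
        (l₂ * radialWeight h₂ s₂ ε₂ b (ℓ y) + c₂)) z).twoPow (q + 1) (T.orientationFrame z) := by
  have hw₁ : ContDiff ℝ ∞ (radialWeight h₁ s₁ ε₁ a) := hh₁.contDiff_radialWeight a
  have hw₂ : ContDiff ℝ ∞ fun y => radialWeight h₂ s₂ ε₂ b (ℓ y) := hh₂.contDiff_radialWeight_comp ℓ b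
  have hA : ContDiff ℝ ∞ fun y => l₁ * radialWeight h₁ s₁ ε₁ a y + c₁ :=
    (contDiff_const.mul hw₁).add contDiff_const
  have hB : ContDiff ℝ ∞ fun y => l₂ * radialWeight h₂ s₂ ε₂ b (ℓ y) + c₂ :=
    (contDiff_const.mul hw₂).add contDiff_const
  refine T.twoPow_ddcForm_orientationFrame_nonneg
    ((hA.of_le (by norm_cast)).contDiffAt.smoothMax (hB.of_le (by norm_cast)).contDiffAt) ?_ hz
  exact levi_smoothMax_nonneg hη (hA.of_le (by norm_cast)).contDiffAt (hB.of_le (by norm_cast)).contDiffAt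
    (levi_const_mul_add_const_nonneg (hw₁.of_le (by norm_cast)) hl₁ c₁
      (fun v => hh₁.levi_radialWeight_nonneg a z v))
    (levi_const_mul_add_const_nonneg (hw₂.of_le (by norm_cast)) hl₂ c₂
      (fun v => hh₂.levi_radialWeight_comp_nonneg ℓ b z v))

end Weights

/-! ### The comparison inequality -/

section Comparison

variable [FiniteDimensional ℂ V] [MeasurableSpace V] [BorelSpace V]
  {Ω : TopologicalSpace.Opens V} {q : ℕ}

/-- **The comparison inequality for Monge–Ampère masses along `[A]`.** Let `u, φ_out` be smooth
weights and `φ_in` any weight, `U' ⊆ Ω` open, `K ⊆ U'` compact, `S ⊆ U'` measurable, with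
`(dd^c u)^{q+1}(ξ_A) ≥ 0` on `reg A`, `u = φ_in` near every point of `reg A ∩ S` and `u = φ_out`
near every point of `reg A ∩ U' ∖ K`. Then
`∫_{reg A ∩ S} (dd^c φ_in)^{q+1}(ξ_A) d𝓗 ≤ ∫_{reg A ∩ U'} (dd^c φ_out)^{q+1}(ξ_A) d𝓗`.
[cite: Chirka1989, §15.1 Prop. 2 (proof)] -/
theorem setIntegral_twoPow_ddcForm_le_of_comparison {A : Set Ω} (hA : HasPureDim 𝓘(ℂ, V) A (q + 1))
    {u φi φo : V → ℝ} (hu : ContDiff ℝ ∞ u) (hφo : ContDiff ℝ ∞ φo)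
    {U' K S : Set V} (hU' : IsOpen U') (hU'Ω : U' ⊆ (Ω : Set V)) (hK : IsCompact K) (hKU' : K ⊆ U')
    (hSU' : S ⊆ U') (hSm : MeasurableSet S)
    (hpsh : ∀ z ∈ (HolomorphicChain.ofSet A hA).carrier,
      0 ≤ (ddcForm u z).twoPow (q + 1) ((HolomorphicChain.ofSet A hA).orientationFrame z))
    (hin : ∀ z ∈ (HolomorphicChain.ofSet A hA).carrier ∩ S, u =ᶠ[𝓝 z] φi)
    (hout : ∀ z ∈ (HolomorphicChain.ofSet A hA).carrier ∩ U', z ∉ K → u =ᶠ[𝓝 z] φo)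
    (hiu : IntegrableOn (fun z => (ddcForm u z).twoPow (q + 1)
      ((HolomorphicChain.ofSet A hA).orientationFrame z))
      ((HolomorphicChain.ofSet A hA).carrier ∩ U') (μHE[2 * (q + 1)] : Measure V))
    (hio : IntegrableOn (fun z => (ddcForm φo z).twoPow (q + 1)
      ((HolomorphicChain.ofSet A hA).orientationFrame z))
      ((HolomorphicChain.ofSet A hA).carrier ∩ U') (μHE[2 * (q + 1)] : Measure V)) :
    ∫ z in (HolomorphicChain.ofSet A hA).carrier ∩ S,
        (ddcForm φi z).twoPow (q + 1) ((HolomorphicChain.ofSet A hA).orientationFrame z)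
        ∂(μHE[2 * (q + 1)] : Measure V) ≤
      ∫ z in (HolomorphicChain.ofSet A hA).carrier ∩ U',
        (ddcForm φo z).twoPow (q + 1) ((HolomorphicChain.ofSet A hA).orientationFrame z)
        ∂(μHE[2 * (q + 1)] : Measure V) := by
  set T := HolomorphicChain.ofSet A hA with hT
  -- (1) Stokes: `∫_{U'} MA u = ∫_{U'} MA φ_out`
  have hsupp : T.carrier ∩ U' ∩ tsupport (fderiv ℝ fun y => u y - φo y) ⊆ K := by
    rintro z ⟨⟨hzc, hzU⟩, hzt⟩
    by_contra hzK
    have hev : (fun y => u y - φo y) =ᶠ[𝓝 z] fun _ => 0 := by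
      filter_upwards [hout z ⟨hzc, hzU⟩ hzK] with y hy
      rw [hy, sub_self]
    have hfd : fderiv ℝ (fun y => u y - φo y) =ᶠ[𝓝 z] 0 := by
      filter_upwards [hev.eventuallyEq_nhds] with y hy
      rw [hy.fderiv_eq]
      simp
    exact (notMem_tsupport_iff_eventuallyEq.2 hfd) hzt
  have hθ : ∀ (w : V → ℝ), EqOn
      (fun z => (ddcForm w z).twoPow (q + 1) (T.orientationFrame z))
      (fun z => (T.density z : ℝ) * (ddcForm w z).twoPow (q + 1) (T.orientationFrame z))
      (T.carrier ∩ U') := fun w z hz => by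
    simp only [hT, HolomorphicChain.density_ofSet_of_mem_carrier hA hz.1, Int.cast_one, one_mul]
  have hmU : MeasurableSet (T.carrier ∩ U') := T.measurableSet_carrier.inter hU'.measurableSet
  have hst := T.setIntegral_twoPow_ddcForm_eq_of_isCompact hu hφo hU' hU'Ω hK hKU' hsupp
    (hiu.congr_fun (hθ u) hmU) (hio.congr_fun (hθ φo) hmU)
  rw [← setIntegral_congr_fun hmU (hθ u), ← setIntegral_congr_fun hmU (hθ φo)] at hst
  rw [← hst]
  -- (2) on `S`, `MA φ_in = MA u`
  have hmS : MeasurableSet (T.carrier ∩ S) := T.measurableSet_carrier.inter hSm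
  have hptw : EqOn (fun z => (ddcForm φi z).twoPow (q + 1) (T.orientationFrame z))
      (fun z => (ddcForm u z).twoPow (q + 1) (T.orientationFrame z)) (T.carrier ∩ S) := by
    intro z hz
    simp only
    rw [ddcForm_eq_of_eventuallyEq_add_const (c := 0) (u := φi) (v := u)
      (by filter_upwards [hin z hz] with y hy; rw [hy, add_zero])]
  rw [setIntegral_congr_fun hmS hptw]
  -- (3) positivity on `U' ∖ S`
  exact setIntegral_mono_set hiu
    ((ae_restrict_mem hmU).mono fun z hz => hpsh z hz.1)
    (inter_subset_inter_right _ hSU').eventuallyLE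

end Comparison

end Literature.Geometry.Kaehler

end
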